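import Literature.Analysis.PDE.LoewnerNirenbergMaximal
import HarnessLib

/-!
# The large solution of the Loewner–Nirenberg equation on balls and on Lipschitz domains

Han–Shen 2020, Thm. 2.1 ("Let `Ω` be a bounded Lipschitz domain in `ℝⁿ`. Then
`Δu = ¼n(n-2)u^{(n+2)/(n-2)}` in `Ω`, `u = ∞` on `∂Ω`, admit a unique positive solution
`u ∈ C^∞(Ω)`"; quoted there as "a well-known result", Loewner–Nirenberg 1974 for `C²` domains) was
vendored as the named fact F2 `existsUnique_isLargeSolution` of `LoewnerNirenbergFacts.lean`; its
proof is a semilinear elliptic existence and regularity theory with no Mathlib support.  This file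
PROVES, sorry-free and fact-free, the parts of it that the tree uses, on top of the comparison
principle and the Keller–Osserman bound of `LoewnerNirenbergMaximal.lean`
(González–Li–Nguyen 2018, Prop. 2.2 and Lemma 3.1):

* **Thm. 2.1 on balls, completely** — `IsSolution.le_ballProfile_of_ball_subset` (every solution
  on an open `Ω ⊇ B(c,R)` lies below the Poincaré profile `u_{R,c} = (2R/(R²-|x-c|²))^{(n-2)/2}`),
  `IsLargeSolution.ballProfile_le` (every large solution of `B(c,R)` lies above it: comparison
  with the profiles of the larger concentric balls, `R' ↓ R`), hence
  **`IsLargeSolution.eqOn_ballProfile`** (the large solution of a ball is unique and is the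
  profile), `isMaximalSolution_ballProfile`, **`loewnerNirenberg_ball_eq`** (LN4:
  `u_{B(c,R)} = u_{R,c}` on `B(c,R)`, with NO hypothesis; `n = 3`:
  `loewnerNirenberg_ball_eq_sqrt`), `isLargeSolution_loewnerNirenberg_ball`.
* **The existence half of Thm. 2.1 on Lipschitz domains, given the maximal solution** —
  `tendsto_atTop_of_forall_isSolution_le`: on an open set with Lipschitz boundary, every function
  dominating all solutions tends to `+∞` at every boundary point (a point of `Ω` at height `t`
  above the local Lipschitz graph sees an exterior ball of radius `t/(1+K)` at distance `2t`, whose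
  exterior solution (Han–Shen 2020, (2.2)) restricts to a solution on `Ω` of size `≍ t^{-(n-2)/2}`
  there); whence UNCONDITIONALLY `tendsto_loewnerNirenberg_atTop` (`u_Ω = ∞` on `∂Ω` for every
  Lipschitz `Ω`, `n ≥ 3`), `IsMaximalSolution.isLargeSolution`, and under F1
  (`exists_isMaximalSolution`) **`isLargeSolution_loewnerNirenberg_of_isLipschitzDomain`** (LN1:
  `u_Ω` is a positive large solution dominating every solution).
* **The uniqueness mechanism** (Loewner–Nirenberg 1974; the maximum-principle step of every
  uniqueness proof for (1.1)–(1.2)) — `IsSolution.le_of_frontier_ratio`: on a bounded open `Ω`,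
  `u ≤ v` as soon as `u ≤ (1+ε)v` near `∂Ω` for every `ε > 0` (`(1+ε)v` is a supersolution,
  `mul_nonlinearity_le`; then González–Li–Nguyen's comparison principle); `….eqOn_of_frontier_ratio`.

What is NOT here: uniqueness of the large solution on a general bounded Lipschitz domain and its
`C^∞` regularity (Han–Shen 2020, Thm. 2.1 as quoted; Loewner–Nirenberg 1974 for `C²` domains;
singular domains: Marcus–Véron 1997, as cited by Han–Shen) — by `IsSolution.eqOn_of_frontier_ratio`
it is reduced to the boundary ratio `u/v → 1`, which is available here on balls and, through the
asymptotics F3 (`boundary_asymptotics`), on `C²` domains; and the existence of the maximal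
solution itself (F1, reduced in `LoewnerNirenbergMaximal.lean` to interior estimates).

## References

* Q. Han, W. Shen, *The Loewner–Nirenberg problem in singular domains*, J. Funct. Anal. 279
  (2020) 108604, arXiv:1511.01146: (1.1)–(1.2), (2.1)–(2.2), Thm. 2.1 (p. 5). [HanShen2020]
* M. d. M. González, Y. Y. Li, L. Nguyen, *Existence and uniqueness to a fully nonlinear version
  of the Loewner–Nirenberg problem*, Commun. Math. Stat. 6 (2018) 269–288, arXiv:1804.08851:
  Prop. 2.2, Lemma 3.1, Lemma 3.2, Def. 4.1. [GonzalezLiNguyen2018]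
* C. Loewner, L. Nirenberg, *Partial differential equations invariant under conformal or
  projective transformations*, Contributions to Analysis, Academic Press (1974), 245–272.
  [LoewnerNirenberg1974]
* M. Marcus, L. Véron, *Uniqueness and asymptotic behavior of solutions with boundary blow-up for
  a class of nonlinear elliptic equations*, Ann. Inst. H. Poincaré Anal. Non Linéaire 14 (1997),
  237–274. [MarcusVeron1997]
-/

noncomputable section

open Set Filter Metric Module TopologicalSpace Bornology
open scoped Laplacian Topology ContDiff

namespace Literature.Analysis.PDE

namespace LoewnerNirenberg

variable {E : Type*} [NormedAddCommGroup E] [InnerProductSpace ℝ E] [FiniteDimensional ℝ E]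

/-! ### Thm. 2.1 on balls -/

section Ball

omit [FiniteDimensional ℝ E] in
/-- The ball profile is continuous in the radius `r` at every `R > ‖x - c‖`. [folklore] -/
theorem continuousAt_ballProfile_radius (c x : E) {R : ℝ} (hR : ‖x - c‖ < R) :
    ContinuousAt (fun r : ℝ => ballProfile c r x) R := by
  unfold ballProfile
  have h0 : 0 ≤ ‖x - c‖ := norm_nonneg _
  have hR0 : 0 < R := h0.trans_lt hR
  have hden : 0 < R ^ 2 - ‖x - c‖ ^ 2 := by nlinarith
  have h1 : ContinuousAt (fun r : ℝ => 2 * r / (r ^ 2 - ‖x - c‖ ^ 2)) R :=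
    ContinuousAt.div (by fun_prop) (by fun_prop) hden.ne'
  exact h1.rpow_const (Or.inl (div_pos (by linarith) hden).ne')

/-- **Every solution on an open `Ω ⊇ B(c,R)` lies below the Poincaré-ball profile `u_{R,c}` on
`B(c,R)`** (González–Li–Nguyen 2018, Lemma 3.1, on the closed balls `B̄(c,r)`, `r ↑ R`; in
particular every solution on the ball itself). [cite: GonzalezLiNguyen2018, Lemma 3.1] -/
theorem IsSolution.le_ballProfile_of_ball_subset (hn : 3 ≤ finrank ℝ E) {Ω : Set E} {u : E → ℝ}
    (hu : IsSolution Ω u) (hΩ : IsOpen Ω) {c : E} {R : ℝ} (hsub : ball c R ⊆ Ω) {x : E}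
    (hx : x ∈ ball c R) : u x ≤ ballProfile c R x := by
  have hxR : ‖x - c‖ < R := by rwa [mem_ball, dist_eq_norm] at hx
  have hle : ∀ᶠ r in 𝓝[<] R, u x ≤ ballProfile c r x := by
    filter_upwards [Ioo_mem_nhdsLT hxR] with r hr
    have hr0 : 0 < r := (norm_nonneg _).trans_lt hr.1
    exact hu.isSubsolution.le_ballProfile hn hΩ hr0 ((closedBall_subset_ball hr.2).trans hsub) x
      (by rw [mem_ball, dist_eq_norm]; exact hr.1)
  exact ge_of_tendsto ((continuousAt_ballProfile_radius c x hxR).tendsto.mono_left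
    nhdsWithin_le_nhds) hle

/-- The ball profile is the maximal solution of its ball, `n ≥ 3` (Han–Shen 2020, (2.1), with
Lemma 3.1 of González–Li–Nguyen 2018). [cite: HanShen2020, (2.1)] -/
theorem isMaximalSolution_ballProfile (hn : 3 ≤ finrank ℝ E) (c : E) {R : ℝ} (hR : 0 < R) :
    IsMaximalSolution (ball c R) (ballProfile c R) where
  toIsSolution := isSolution_ballProfile c hR
  le := fun _ hv _ hx => hv.le_ballProfile_of_ball_subset hn isOpen_ball Subset.rfl hx

/-- **LN4 (ball) — `u_{B(c,R)} = (2R/(R² - |x-c|²))^{(n-2)/2}` on `B(c,R)`**, `n ≥ 3`, `R > 0`, with no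
hypothesis: the profile is a solution of the ball dominating every solution of the ball
(Han–Shen 2020, Thm. 2.1 with (2.1)). [cite: HanShen2020, Thm. 2.1 and (2.1)] -/
theorem loewnerNirenberg_ball_eq (hn : 3 ≤ finrank ℝ E) (c : E) {R : ℝ} (hR : 0 < R) :
    EqOn (loewnerNirenberg (ball c R)) (ballProfile c R) (ball c R) :=
  (isMaximalSolution_ballProfile hn c hR).eqOn_loewnerNirenberg

/-- **LN4 (ball, `n = 3`)**: `u_{B(c,R)}(x) = √(2R/(R² - |x-c|²))` — the profile of the route item
`OnePointLaw` of CriticalPhenomena/BallOrbitComparison. [cite: HanShen2020, Thm. 2.1 and (2.1)] -/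
theorem loewnerNirenberg_ball_eq_sqrt (hE : finrank ℝ E = 3) (c : E) {R : ℝ} (hR : 0 < R)
    {x : E} (hx : x ∈ ball c R) :
    loewnerNirenberg (ball c R) x = Real.sqrt (2 * R / (R ^ 2 - ‖x - c‖ ^ 2)) := by
  rw [loewnerNirenberg_ball_eq (by omega) c hR hx, ballProfile_eq_sqrt_of_finrank_eq_three hE]

/-- **A large solution of a ball dominates the ball profile** (`n ≥ 3`): if `v` solves the equation
on `B(c,R)` with `v = ∞` on the sphere, then `u_{R,c} ≤ v` on `B(c,R)` — the profile `u_{R',c}` of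
every larger concentric ball is a solution on `B(c,R') ⊇ B̄(c,R)`, hence lies below the large
solution `v` (comparison principle, González–Li–Nguyen 2018, Prop. 2.2), and `u_{R',c} → u_{R,c}`
as `R' ↓ R`. [cite: HanShen2020, Thm. 2.1 and (2.1)] -/
theorem IsLargeSolution.ballProfile_le (hn : 3 ≤ finrank ℝ E) {c : E} {R : ℝ}
    {v : E → ℝ} (hv : IsLargeSolution (ball c R) v) {x : E} (hx : x ∈ ball c R) :
    ballProfile c R x ≤ v x := by
  have hxR : ‖x - c‖ < R := by rwa [mem_ball, dist_eq_norm] at hx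
  have hR : 0 < R := (norm_nonneg _).trans_lt hxR
  have key : ∀ᶠ R' in 𝓝[>] R, ballProfile c R' x ≤ v x := by
    filter_upwards [self_mem_nhdsWithin] with R' hRR'
    have hsub : closure (ball c R) ⊆ ball c R' := by
      rw [closure_ball c hR.ne']
      exact closedBall_subset_ball hRR'
    exact hv.ge_of_isSolution hn isOpen_ball isBounded_ball isOpen_ball hsub
      (isSolution_ballProfile c (hR.trans hRR')) x hx
  have hlim : Tendsto (fun r : ℝ => ballProfile c r x) (𝓝[>] R) (𝓝 (ballProfile c R x)) :=
    (continuousAt_ballProfile_radius c x hxR).tendsto.mono_left nhdsWithin_le_nhds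
  exact le_of_tendsto hlim key

/-- **Thm. 2.1 on balls — uniqueness of the large solution**: every solution of the
Loewner–Nirenberg equation on `B(c,R)` with `u = ∞` on the sphere is the Poincaré-ball profile
`(2R/(R² - |x-c|²))^{(n-2)/2}`, `n ≥ 3` (Han–Shen 2020, Thm. 2.1 with (2.1); PROVED).
[cite: HanShen2020, Thm. 2.1 and (2.1)] -/
theorem IsLargeSolution.eqOn_ballProfile (hn : 3 ≤ finrank ℝ E) {c : E} {R : ℝ} {v : E → ℝ}
    (hv : IsLargeSolution (ball c R) v) : EqOn v (ballProfile c R) (ball c R) :=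
  fun _ hx => le_antisymm
    (hv.toIsSolution.le_ballProfile_of_ball_subset hn isOpen_ball Subset.rfl hx)
    (hv.ballProfile_le hn hx)

/-- **Thm. 2.1 on balls for `u_{B(c,R)}`**: `u_{B(c,R)}` is a positive large solution of the ball and
every large solution of the ball equals it (`n ≥ 3`, `R > 0`; no hypothesis).
[cite: HanShen2020, Thm. 2.1 and (2.1)] -/
theorem isLargeSolution_loewnerNirenberg_ball (hn : 3 ≤ finrank ℝ E) (c : E) {R : ℝ}
    (hR : 0 < R) :
    IsLargeSolution (ball c R) (loewnerNirenberg (ball c R)) ∧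
      (∀ x ∈ ball c R, 0 < loewnerNirenberg (ball c R) x) ∧
      ∀ v : E → ℝ, IsLargeSolution (ball c R) v →
        EqOn v (loewnerNirenberg (ball c R)) (ball c R) := by
  have heq := loewnerNirenberg_ball_eq hn c hR
  have hlarge : IsLargeSolution (ball c R) (loewnerNirenberg (ball c R)) :=
    ⟨(isLargeSolution_ballProfile hn c hR).toIsSolution.congr isOpen_ball heq,
      fun z hz => (tendsto_ballProfile_atTop hn c hR hz).congr'
        (eventually_mem_nhdsWithin.mono fun x hx => (heq hx).symm)⟩
  refine ⟨hlarge, fun x hx => ?_, fun v hv x hx => ?_⟩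
  · rw [heq hx]; exact ballProfile_pos hR hx
  · rw [heq hx]; exact hv.eqOn_ballProfile hn hx

end Ball

/-! ### Thm. 2.1 on Lipschitz domains: blow-up of the maximal solution at the boundary -/

section Lipschitz

open Literature.Analysis.FunctionSpaces

/-- The algebra of the exterior-ball comparison: with `ρ = t/(1+K)` and `|y - p| = 2t`,
`2ρ/((2t)² - ρ²) = A/t` for `A = (2/(1+K))/(4 - (1+K)⁻²)`. [folklore] -/
theorem exteriorBall_base_eq {K t : ℝ} (hK : 0 ≤ K) (ht : 0 < t) :
    2 * (t / (1 + K)) / ((2 * t) ^ 2 - (t / (1 + K)) ^ 2) =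
      (2 / (1 + K)) / (4 - ((1 + K)⁻¹) ^ 2) * t⁻¹ := by
  have h1K : (1 + K) ≠ 0 := by positivity
  have ht' : t ≠ 0 := ht.ne'
  have hden : (4 : ℝ) - ((1 + K)⁻¹) ^ 2 ≠ 0 := by
    have h1 : (1 + K)⁻¹ ≤ 1 := inv_le_one_of_one_le₀ (by linarith)
    have h2 : 0 < (1 + K)⁻¹ := by positivity
    nlinarith
  rw [div_eq_mul_inv t (1 + K)]
  field_simp
  ring

/-- **Blow-up at Lipschitz boundary points of every function dominating all solutions** (the
existence half of Han–Shen 2020, Thm. 2.1, given a maximal solution; Loewner–Nirenberg 1974): let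
`n ≥ 3`, `Ω` open with Lipschitz boundary, and `u : E → ℝ` with `v ≤ u` on `Ω` for every solution
`v` on `Ω`. Then `u(y) → +∞` as `y → z` within `Ω`, for every `z ∈ ∂Ω`.  Proof: near `z`, `Ω` is
the strict epigraph `{γ(P y) < ⟪y, e⟫}` of a `K`-Lipschitz `γ`; a point `y ∈ Ω` at height
`t = ⟪y, e⟫ - γ(P y)` above the graph sees the closed ball `B̄(y - 2t e, t/(1+K))`, which misses
`Ω`, so the exterior solution (2.2) of that ball is a solution on `Ω`, whence
`u(y) ≥ (2ρ/((2t)² - ρ²))^{(n-2)/2} = (A/t)^{(n-2)/2} → ∞` since `t ≤ (1+K)|y - z| → 0`.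
[cite: HanShen2020, Thm. 2.1 (existence part) and (2.2)] -/
theorem tendsto_atTop_of_forall_isSolution_le (hn : 3 ≤ finrank ℝ E) {Ω : Opens E}
    (hL : IsLipschitzDomain Ω) {u : E → ℝ}
    (hmax : ∀ v : E → ℝ, IsSolution (Ω : Set E) v → ∀ x ∈ (Ω : Set E), v x ≤ u x) {z : E}
    (hz : z ∈ frontier (Ω : Set E)) : Tendsto u (𝓝[(Ω : Set E)] z) atTop := by
  obtain ⟨k, hk⟩ : ∃ k : ℝ, ((finrank ℝ E : ℝ) - 2) / 2 = k := ⟨_, rfl⟩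
  have hk0 : 0 < k := by
    have : (3 : ℝ) ≤ finrank ℝ E := by exact_mod_cast hn
    rw [← hk]; linarith
  obtain ⟨r, hr, e, he, γ, ⟨K, hK0⟩, hγ, hΩr⟩ := hL z hz
  -- the projection `P` along `e` and the Lipschitz bound
  obtain ⟨P, hP⟩ : ∃ P : E → E, ∀ y, P y = y - inner ℝ y e • e := ⟨_, fun y => rfl⟩
  have hPc : Continuous P := continuous_projAlong hP
  have hγL : ∀ a b, γ a ≤ γ b + K * ‖a - b‖ := fun a b => by
    have h1 : dist (γ a) (γ b) ≤ K * dist a b := hγ.dist_le_mul a b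
    rw [Real.dist_eq, dist_eq_norm] at h1
    linarith [(abs_sub_le_iff.1 h1).1]
  -- membership in `Ω` inside the ball `B(z, r)`
  have memΩ : ∀ y, y ∈ ball z r → (y ∈ (Ω : Set E) ↔ γ (P y) < inner ℝ y e) := by
    intro y hy
    rw [hP]
    constructor
    · intro hyΩ
      have : y ∈ (Ω : Set E) ∩ ball z r := ⟨hyΩ, hy⟩
      rw [hΩr] at this
      exact this.2
    · intro hlt
      have : y ∈ (Ω : Set E) ∩ ball z r := by rw [hΩr]; exact ⟨hy, hlt⟩
      exact this.1
  -- `γ (P z) = ⟪z, e⟫` at the boundary point `z`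
  have hzΩ : z ∉ (Ω : Set E) := fun h =>
    (Set.ext_iff.1 Ω.isOpen.inter_frontier_eq z).1 ⟨h, hz⟩
  have hγ_ge : inner ℝ z e ≤ γ (P z) := by
    by_contra hlt
    push Not at hlt
    exact hzΩ ((memΩ z (mem_ball_self hr)).2 hlt)
  have hγ_le : γ (P z) ≤ inner ℝ z e := by
    by_contra hlt
    push Not at hlt
    have hA : {y | inner ℝ y e < γ (P y)} ∩ ball z r ∈ 𝓝 z := by
      refine inter_mem (IsOpen.mem_nhds ?_ hlt) (ball_mem_nhds z hr)
      exact isOpen_lt (continuous_id.inner continuous_const) (hγ.continuous.comp hPc)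
    obtain ⟨y, ⟨hy1, hy2⟩, hyΩ⟩ := mem_closure_iff_nhds.1 (frontier_subset_closure hz) _ hA
    exact lt_asymm hy1 ((memΩ y hy2).1 hyΩ)
  have hγz : γ (P z) = inner ℝ z e := le_antisymm hγ_le hγ_ge
  -- the height `t(y) = ⟪y, e⟫ - γ(P y)` above the graph
  obtain ⟨hgt, hhgt⟩ : ∃ hgt : E → ℝ, ∀ y, hgt y = inner ℝ y e - γ (P y) := ⟨_, fun y => rfl⟩
  have hhc : Continuous hgt := by
    have : hgt = fun y => inner ℝ y e - γ (P y) := funext hhgt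
    rw [this]
    exact (continuous_id.inner continuous_const).sub (hγ.continuous.comp hPc)
  have hhz : hgt z = 0 := by rw [hhgt, hγz, sub_self]
  have hhpos : ∀ y ∈ (Ω : Set E), y ∈ ball z r → 0 < hgt y := fun y hy hyb => by
    rw [hhgt]; exact sub_pos.2 ((memΩ y hyb).1 hy)
  have hhle : ∀ y, hgt y ≤ (1 + K) * ‖y - z‖ := by
    intro y
    have h1 : inner ℝ y e - inner ℝ z e ≤ ‖y - z‖ := by
      rw [← inner_sub_left]
      exact (le_abs_self _).trans (abs_inner_unit_le he _)
    have h2 : γ (P z) ≤ γ (P y) + K * ‖P z - P y‖ := hγL _ _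
    have h3 : ‖P z - P y‖ ≤ ‖y - z‖ := by
      rw [projAlong_sub hP, norm_sub_rev y z]
      exact norm_projAlong_le he hP _
    have h4 : K * ‖P z - P y‖ ≤ K * ‖y - z‖ := mul_le_mul_of_nonneg_left h3 hK0
    rw [hhgt]
    linarith
  -- the constant `A` of the comparison function `(A / t)^k`
  have h1K : 0 < 1 + K := by linarith
  obtain ⟨A, hA⟩ : ∃ A : ℝ, (2 / (1 + K)) / (4 - ((1 + K)⁻¹) ^ 2) = A := ⟨_, rfl⟩
  have hA0 : 0 < A := by
    have hden4 : 0 < (4 : ℝ) - ((1 + K)⁻¹) ^ 2 := by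
      have h1 : (1 + K)⁻¹ ≤ 1 := inv_le_one_of_one_le₀ (by linarith)
      have h2 : 0 < (1 + K)⁻¹ := by positivity
      nlinarith
    rw [← hA]; positivity
  -- (i) `(A / t(y))^k → ∞` as `y → z` within `Ω`
  have hlim : Tendsto (fun y => (A * (hgt y)⁻¹) ^ k) (𝓝[(Ω : Set E)] z) atTop := by
    have hh0 : Tendsto hgt (𝓝[(Ω : Set E)] z) (𝓝[>] 0) := by
      refine tendsto_nhdsWithin_iff.2 ⟨?_, ?_⟩
      · simpa [hhz] using (hhc.tendsto z).mono_left nhdsWithin_le_nhds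
      · have hb : ∀ᶠ y in 𝓝[(Ω : Set E)] z, y ∈ ball z r :=
          mem_nhdsWithin_of_mem_nhds (ball_mem_nhds z hr)
        filter_upwards [hb, self_mem_nhdsWithin] with y hyb hy using hhpos y hy hyb
    exact (tendsto_rpow_atTop hk0).comp ((tendsto_inv_nhdsGT_zero.comp hh0).const_mul_atTop hA0)
  -- (ii) eventually `(A / t(y))^k ≤ u y`, by comparison with exterior balls
  have hK34 : 0 < 4 + 3 * K := by linarith
  have hle : ∀ᶠ y in 𝓝[(Ω : Set E)] z, (A * (hgt y)⁻¹) ^ k ≤ u y := by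
    have hb : ∀ᶠ y in 𝓝[(Ω : Set E)] z, y ∈ ball z (r / (4 + 3 * K)) :=
      mem_nhdsWithin_of_mem_nhds (ball_mem_nhds z (div_pos hr hK34))
    filter_upwards [hb, self_mem_nhdsWithin] with y hyb hy
    have hyz : ‖y - z‖ < r / (4 + 3 * K) := by rwa [mem_ball, dist_eq_norm] at hyb
    have hyz' : (4 + 3 * K) * ‖y - z‖ < r := by
      rwa [lt_div_iff₀ hK34, mul_comm] at hyz
    have hyr : y ∈ ball z r := by
      rw [mem_ball, dist_eq_norm]
      have : ‖y - z‖ ≤ (4 + 3 * K) * ‖y - z‖ := by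
        have := norm_nonneg (y - z)
        nlinarith
      linarith
    -- the height `t > 0`, the radius `ρ = t/(1+K)` and the centre `p = y - 2t e`
    obtain ⟨t, ht⟩ : ∃ t : ℝ, hgt y = t := ⟨_, rfl⟩
    have ht0 : 0 < t := ht ▸ hhpos y hy hyr
    have htK : t ≤ (1 + K) * ‖y - z‖ := ht ▸ hhle y
    obtain ⟨ρ, hρ⟩ : ∃ ρ : ℝ, t / (1 + K) = ρ := ⟨_, rfl⟩
    have hρ0 : 0 < ρ := hρ ▸ div_pos ht0 h1K
    have hρK : (1 + K) * ρ = t := by rw [← hρ]; field_simp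
    have hρt : ρ ≤ t := by
      rw [← hρK]
      have : 0 ≤ K * ρ := mul_nonneg hK0 hρ0.le
      linarith
    obtain ⟨p, hp⟩ : ∃ p : E, y + (-(2 * t)) • e = p := ⟨_, rfl⟩
    have hyp : y - p = (2 * t) • e := by rw [← hp, neg_smul]; abel
    have hnyp : ‖y - p‖ = 2 * t := by
      rw [hyp, norm_smul, Real.norm_eq_abs, abs_of_pos (by linarith), he, mul_one]
    have hPp : P p = P y := by rw [← hp, projAlong_add_smul he hP]
    have hpe : inner ℝ p e = inner ℝ y e - 2 * t := by
      rw [← hp, inner_add_left, real_inner_smul_left, real_inner_self_eq_norm_sq, he]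
      ring
    -- `B̄(p, ρ) ⊆ B(z, r)`
    have hballr : closedBall p ρ ⊆ ball z r := by
      intro q hq
      rw [mem_closedBall, dist_eq_norm] at hq
      rw [mem_ball, dist_eq_norm]
      have h1 : ‖q - z‖ ≤ ‖q - p‖ + ‖p - y‖ + ‖y - z‖ := by
        calc ‖q - z‖ = ‖(q - p) + (p - y) + (y - z)‖ := by congr 1; abel
          _ ≤ ‖q - p‖ + ‖p - y‖ + ‖y - z‖ := norm_add₃_le
      have h2 : ‖p - y‖ = 2 * t := by rw [norm_sub_rev, hnyp]
      nlinarith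
    -- `B̄(p, ρ)` misses `Ω`
    have hdisj : ∀ q ∈ closedBall p ρ, q ∉ (Ω : Set E) := by
      intro q hq hqΩ
      have hlt : γ (P q) < inner ℝ q e := (memΩ q (hballr hq)).1 hqΩ
      rw [mem_closedBall, dist_eq_norm] at hq
      have h1 : inner ℝ q e ≤ inner ℝ p e + ‖q - p‖ := by
        have h := abs_inner_unit_le he (q - p)
        rw [inner_sub_left] at h
        linarith [(abs_le.1 h).2]
      have h2 : γ (P y) ≤ γ (P q) + K * ‖P y - P q‖ := hγL _ _
      have h3 : ‖P y - P q‖ ≤ ‖q - p‖ := by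
        rw [← hPp, projAlong_sub hP, norm_sub_rev q p]
        exact norm_projAlong_le he hP _
      have h4 : K * ‖P y - P q‖ ≤ K * ρ := mul_le_mul_of_nonneg_left (h3.trans hq) hK0
      have h5 : t = inner ℝ y e - γ (P y) := by rw [← ht, hhgt]
      linarith
    have hsub : (Ω : Set E) ⊆ (closedBall p ρ)ᶜ := fun q hq hqb => hdisj q hqb hq
    -- comparison with the exterior solution of `B̄(p, ρ)`
    have hcmp := hmax _ ((isSolution_exteriorProfile p hρ0).mono hsub) y hy
    have hval : exteriorProfile p ρ y = (A * t⁻¹) ^ k := by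
      rw [exteriorProfile, hk, hnyp, ← hA, ← hρ, exteriorBall_base_eq hK0 ht0]
    rw [ht, ← hval]
    exact hcmp
  exact tendsto_atTop_mono' _ hle hlim

/-- **`u_Ω = ∞` on `∂Ω` for every open set with Lipschitz boundary, unconditionally**: for `n ≥ 3`
and `z ∈ ∂Ω`, `u_Ω(y) → +∞` as `y → z` within `Ω` (every solution lies below `u_Ω`,
`IsSolution.le_loewnerNirenberg_of_isOpen`; whether or not `u_Ω` is itself a solution).
[cite: HanShen2020, Thm. 2.1 (existence part) and (2.2)] -/
theorem tendsto_loewnerNirenberg_atTop (hn : 3 ≤ finrank ℝ E) {Ω : Opens E}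
    (hL : IsLipschitzDomain Ω) {z : E} (hz : z ∈ frontier (Ω : Set E)) :
    Tendsto (loewnerNirenberg (Ω : Set E)) (𝓝[(Ω : Set E)] z) atTop :=
  tendsto_atTop_of_forall_isSolution_le hn hL
    (fun _ hv _ hx => hv.le_loewnerNirenberg_of_isOpen hn Ω.isOpen hx) hz

/-- **A solution of a Lipschitz domain dominating all solutions is a large solution** (`n ≥ 3`).
[cite: HanShen2020, Thm. 2.1 (existence part) and (2.2)] -/
theorem IsSolution.isLargeSolution_of_forall_le (hn : 3 ≤ finrank ℝ E) {Ω : Opens E}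
    (hL : IsLipschitzDomain Ω) {u : E → ℝ} (hu : IsSolution (Ω : Set E) u)
    (hmax : ∀ v : E → ℝ, IsSolution (Ω : Set E) v → ∀ x ∈ (Ω : Set E), v x ≤ u x) :
    IsLargeSolution (Ω : Set E) u :=
  ⟨hu, fun _ hz => tendsto_atTop_of_forall_isSolution_le hn hL hmax hz⟩

/-- **The maximal solution of a Lipschitz domain is its large solution** (`n ≥ 3`; the existence
half of Han–Shen 2020, Thm. 2.1, in the construction of Loewner–Nirenberg 1974 /
González–Li–Nguyen 2018, Def. 4.1). [cite: HanShen2020, Thm. 2.1 (existence part) and (2.2)] -/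
theorem IsMaximalSolution.isLargeSolution (hn : 3 ≤ finrank ℝ E) {Ω : Opens E}
    (hL : IsLipschitzDomain Ω) {u : E → ℝ} (hu : IsMaximalSolution (Ω : Set E) u) :
    IsLargeSolution (Ω : Set E) u :=
  hu.toIsSolution.isLargeSolution_of_forall_le hn hL fun _ hv _ hx => hu.le hv hx

/-- **LN1 — `u_Ω` is a positive large solution, and the maximal one** (under F1): for a bounded
Lipschitz domain `Ω`, `n ≥ 3`, the Loewner–Nirenberg function `u_Ω` solves the equation, is
positive, tends to `+∞` at every boundary point, and dominates every solution on `Ω` (Han–Shen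
2020, Thm. 2.1, existence part; maximality: González–Li–Nguyen 2018, Def. 4.1).  The uniqueness of
the positive large solution on Lipschitz domains (ibid., quoting Loewner–Nirenberg 1974 for `C²`
domains) is not vendored; its mechanism is `IsSolution.le_of_frontier_ratio` below, and on balls it
is `IsLargeSolution.eqOn_ballProfile`.
[cite: HanShen2020, Thm. 2.1 (existence part); GonzalezLiNguyen2018, Def. 4.1] -/
theorem isLargeSolution_loewnerNirenberg_of_isLipschitzDomain
    (h1 : exists_isMaximalSolution (E := E)) (hn : 3 ≤ finrank ℝ E) (Ω : Opens E)
    (hb : IsBounded (Ω : Set E)) (hconn : IsConnected (Ω : Set E)) (hL : IsLipschitzDomain Ω) :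
    IsLargeSolution (Ω : Set E) (loewnerNirenberg (Ω : Set E)) ∧
      (∀ x ∈ (Ω : Set E), 0 < loewnerNirenberg (Ω : Set E) x) ∧
      ∀ v : E → ℝ, IsSolution (Ω : Set E) v → ∀ x ∈ (Ω : Set E),
        v x ≤ loewnerNirenberg (Ω : Set E) x := by
  haveI := nontrivial_of_three_le_finrank hn
  have hc : (closure (Ω : Set E))ᶜ.Nonempty := exists_notMem_closure_of_isBounded hb
  have hmax := isMaximalSolution_loewnerNirenberg h1 hn Ω.isOpen hconn hc
  exact ⟨hmax.isLargeSolution hn hL, fun x hx => loewnerNirenberg_pos_of_isOpen hn Ω.isOpen hc hx,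
    fun v hv x hx => hmax.le hv hx⟩

end Lipschitz

/-! ### The uniqueness mechanism: comparison from the boundary ratio -/

section Uniqueness

/-- The exponent `(n+2)/(n-2)` is at least `1` for `n ≥ 3`. [folklore] -/
theorem one_le_exponent {n : ℕ} (hn : 3 ≤ n) : 1 ≤ exponent n := by
  unfold exponent
  have : (3 : ℝ) ≤ n := by exact_mod_cast hn
  rw [one_le_div (by linarith)]
  linarith

/-- **Superlinearity of the nonlinearity**: `(1+ε) f_n(t) ≤ f_n((1+ε) t)` for `ε, t ≥ 0`, `n ≥ 3`
(so that `(1+ε) v` is a supersolution whenever `v` is a solution). [folklore] -/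
theorem mul_nonlinearity_le {n : ℕ} (hn : 3 ≤ n) {ε t : ℝ} (hε : 0 ≤ ε) (ht : 0 ≤ t) :
    (1 + ε) * nonlinearity n t ≤ nonlinearity n ((1 + ε) * t) := by
  simp only [nonlinearity]
  rw [Real.mul_rpow (by linarith) ht]
  have h1 : (1 + ε) ≤ (1 + ε) ^ exponent n := by
    conv_lhs => rw [← Real.rpow_one (1 + ε)]
    exact Real.rpow_le_rpow_of_exponent_le (by linarith) (one_le_exponent hn)
  have hc : 0 ≤ coeff n * t ^ exponent n := mul_nonneg (coeff_pos hn).le (Real.rpow_nonneg ht _)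
  calc (1 + ε) * (coeff n * t ^ exponent n)
      ≤ (1 + ε) ^ exponent n * (coeff n * t ^ exponent n) := mul_le_mul_of_nonneg_right h1 hc
    _ = coeff n * ((1 + ε) ^ exponent n * t ^ exponent n) := by ring

/-- **A positive multiple `(1+ε) v`, `ε ≥ 0`, of a solution is a (classical) supersolution**:
`Δ((1+ε)v) = (1+ε) f_n(v) ≤ f_n((1+ε)v)` on `Ω`. [folklore] -/
theorem IsSolution.laplacian_const_mul_le (hn : 3 ≤ finrank ℝ E) {Ω : Set E} {v : E → ℝ}
    (hv : IsSolution Ω v) {ε : ℝ} (hε : 0 ≤ ε) {x : E} (hx : x ∈ Ω) :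
    (Δ (fun y => (1 + ε) * v y)) x ≤ nonlinearity (finrank ℝ E) ((1 + ε) * v x) := by
  have h1 := laplacian_const_smul' (1 + ε) v x
  simp only [smul_eq_mul] at h1
  rw [h1, hv.laplacian_eq hx]
  exact mul_nonlinearity_le hn hε (hv.nonneg hx)

/-- **The Loewner–Nirenberg uniqueness mechanism.** Let `n ≥ 3`, `Ω` bounded and open, and `u`, `v`
solutions on `Ω` such that for every `ε > 0` and every `z ∈ ∂Ω`, `u ≤ (1+ε) v` near `z` within `Ω`
(e.g. `u/v → 1` at `∂Ω`). Then `u ≤ v` on `Ω`: `(1+ε)v` is a supersolution above `u` at the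
boundary, so `u ≤ (1+ε)v` on `Ω` by the comparison principle (González–Li–Nguyen 2018,
Prop. 2.2: at a positive interior maximum of `u - (1+ε)v`, `Δ ≤ 0 < f_n(u) - f_n((1+ε)v)`), and
`ε ↓ 0`.  This is the maximum-principle step of the uniqueness of the large solution
(Loewner–Nirenberg 1974 for `C²` domains, where `d^{(n-2)/2}u → 1`; Han–Shen 2020, Thm. 2.1).
[cite: HanShen2020, Thm. 2.1 (uniqueness step); GonzalezLiNguyen2018, Prop. 2.2] -/
theorem IsSolution.le_of_frontier_ratio (hn : 3 ≤ finrank ℝ E) {Ω : Set E} (hΩ : IsOpen Ω)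
    (hb : IsBounded Ω) {u v : E → ℝ} (hu : IsSolution Ω u) (hv : IsSolution Ω v)
    (h : ∀ ε : ℝ, 0 < ε → ∀ z ∈ frontier Ω, ∀ᶠ x in 𝓝[Ω] z, u x ≤ (1 + ε) * v x) {x : E}
    (hx : x ∈ Ω) : u x ≤ v x := by
  -- Step 1: `u ≤ (1+ε) v` on `Ω` for every `ε > 0`, by comparison with the supersolution `(1+ε)v`
  have key : ∀ ε : ℝ, 0 < ε → u x ≤ (1 + ε) * v x := by
    intro ε hε
    refine comparison hn hΩ hb hu.isSubsolution (contDiffOn_const.mul hv.contDiffOn)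
      (fun y hy => mul_nonneg (by linarith) (hv.nonneg hy))
      (fun y hy => hv.laplacian_const_mul_le hn hε.le hy) (fun z hz η hη => ?_) x hx
    filter_upwards [h ε hε z hz] with y hy
    linarith
  -- Step 2: `ε ↓ 0`
  have hv0 : 0 ≤ v x := hv.nonneg hx
  refine le_of_forall_pos_lt_add fun η hη => ?_
  have h1 := key (η / (v x + 1)) (by positivity)
  have h2 : η / (v x + 1) * v x < η := by
    rw [div_mul_eq_mul_div, div_lt_iff₀ (by positivity)]
    nlinarith
  nlinarith

/-- **Uniqueness of the large solution from the boundary ratio**: two solutions on a bounded open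
`Ω` with `u/v → 1` at `∂Ω` (in the form: `u ≤ (1+ε)v` and `v ≤ (1+ε)u` near each boundary point,
for every `ε > 0`) coincide on `Ω`.
[cite: HanShen2020, Thm. 2.1 (uniqueness step); GonzalezLiNguyen2018, Prop. 2.2] -/
theorem IsSolution.eqOn_of_frontier_ratio (hn : 3 ≤ finrank ℝ E) {Ω : Set E} (hΩ : IsOpen Ω)
    (hb : IsBounded Ω) {u v : E → ℝ} (hu : IsSolution Ω u) (hv : IsSolution Ω v)
    (huv : ∀ ε : ℝ, 0 < ε → ∀ z ∈ frontier Ω, ∀ᶠ x in 𝓝[Ω] z, u x ≤ (1 + ε) * v x)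
    (hvu : ∀ ε : ℝ, 0 < ε → ∀ z ∈ frontier Ω, ∀ᶠ x in 𝓝[Ω] z, v x ≤ (1 + ε) * u x) :
    EqOn u v Ω := fun _ hx =>
  le_antisymm (hu.le_of_frontier_ratio hn hΩ hb hv huv hx)
    (hv.le_of_frontier_ratio hn hΩ hb hu hvu hx)

end Uniqueness

end LoewnerNirenberg

end Literature.Analysis.PDE
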